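import Literature.RingTheory.HilbertSamuel.LocalizedPolynomial
import Mathlib.RingTheory.KrullDimension.Polynomial
import HarnessLib

/-!
# `dim A(X) = dim A` for noetherian local `A` (complement to `LocalizedPolynomial.lean`)

Topic: `Literature/RingTheory/HilbertSamuel`. For a noetherian local ring `A` the ring
`A(X) = A[X]_{𝔪A[X]}` of `LocalizedPolynomial.lean` (the base change to an infinite residue field
used in CJS 2020, Lemma 2.14 (a) / Lemma 2.23) has the SAME dimension: `dim A(X) = ht(𝔪A[X])`
(dimension of a localisation at a prime) `= ht 𝔪` (Mathlib's `Polynomial.height_map_C`, which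
needs `A` noetherian) `= dim A`. Proved here; `LocalizedPolynomial.lean` keeps the
hypothesis-free inequality `dim A ≤ dim A(X)`.

## Sources

* V. Cossart, U. Jannsen, S. Saito, LNM 2270 (2020), Lemma 2.14 (a) (proof), Lemma 2.27 (1).
  [CossartJannsenSaito2020]
-/

noncomputable section

open IsLocalRing Polynomial

namespace Literature.RingTheory.HilbertSamuel

universe u

variable (A : Type u) [CommRing A] [IsLocalRing A] [IsNoetherianRing A]

/-- **`dim A(X) = dim A`** for a noetherian local ring `A`. [folklore] -/
theorem ringKrullDim_localizedPolynomial :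
    ringKrullDim (LocalizedPolynomial A) = ringKrullDim A := by
  rw [IsLocalization.AtPrime.ringKrullDim_eq_height ((maximalIdeal A).map (C : A →+* A[X]))
      (LocalizedPolynomial A), Polynomial.height_map_C, IsLocalRing.maximalIdeal_height_eq_ringKrullDim]

end Literature.RingTheory.HilbertSamuel

end
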